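import Literature.AlgebraicGeometry.Motives.LocalSystems
import Mathlib.Topology.Homotopy.Path
import Mathlib.LinearAlgebra.Quotient.Basic
import HarnessLib

/-!
# `H¹` of a local system and the parabolic cohomology `H¹(S̄, j_*𝕍)`

Family `hodge`, layer `Literature/AlgebraicGeometry/Motives`; companion of `Motives/LocalSystems`
(local systems as functors `Π₁(S) ⥤ Mod_R`, Deligne 1970 I.1). For a local system `𝕍` on `S`:

* `LocalSystem.oneCocycles 𝕍` — the twisted `1`-cocycles on the fundamental groupoid: functions
  `c(γ) ∈ 𝕍_t` of homotopy classes of paths `γ : s ⇝ t` with `c(γ · δ) = δ_* c(γ) + c(δ)`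
  (crossed homomorphisms); `oneCoboundary v : γ ↦ v(t) − γ_* v(s)` for a family `v(s) ∈ 𝕍_s`;
  `H1 𝕍 = Z¹/B¹`. On a path-connected `S` restriction to loops at `s` identifies this with the
  group cohomology `H¹(π₁(S, s), 𝕍_s)` (the groupoid is equivalent to the group), which is the
  first cohomology `H¹(S; 𝕍)` with local coefficients whenever `S` has a universal cover
  (five-term sequence of `S̃ → S`: `H¹(S̃; V) = Hom(H₁(S̃), V) = 0`; Hatcher §3.H).
* `LocalSystem.IsCoboundaryOn 𝕍 c W` — `c` restricted to the paths of a subset `W ⊆ S` is a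
  coboundary there (the extension of local systems `0 → 𝕍 → 𝕍̂ → R → 0` classified by `c` splits
  over `W`).
* For `𝕍` on a subspace `U ⊆ T` (`j : U ↪ T`; the case of interest: `T = S̄` a compact Riemann
  surface, `U = S̄ ∖ D`, `D` finite): `IsParabolicAt 𝕍 c b` — `c` is a coboundary over `N ∩ U` for
  some neighbourhood `N` of `b ∈ T`; `parabolicCocycles`, and the **parabolic cohomology**
  `parabolicH1 𝕍 ⊆ H1 𝕍`, the image of the parabolic cocycles: "Recall that the space `H¹(S, 𝕍)`
  is naturally identified with the space of extension classes `0 → 𝕍 → 𝕍̂ → ℂ_S → 0` of local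
  systems on `S`. The parabolic subspace `H¹(S̄, j_*𝕍) ⊂ H¹(S, 𝕍)` consists precisely of those
  extensions which split locally near each point `p ∈ D`" (del Angel–Müller-Stach–van Straten–Zuo,
  §4; equivalently, by the Leray sequence of `j`, `H¹(S̄, j_*𝕍) = ker (H¹(S, 𝕍) → ⊕_p (R¹j_*𝕍)_p)`
  with `(R¹j_*𝕍)_p = colim_N H¹(N ∩ S, 𝕍)`; at points of `U` itself the condition is empty as
  soon as `U` is locally simply connected). This is the group on which Zucker (1979) puts a pure
  Hodge structure of weight `k + 1` when `𝕍` underlies a weight-`k` VHS on a curve ("the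
  intersection homology group (also called the parabolic cohomology group) `H¹(S̄, j_*𝕍)` then
  carries a natural Hodge structure of weight `k+1`, a result due to S. Zucker", loc. cit. §0),
  used by Doran–Harder–Novoseltsev–Thompson 2019, Lemma 2.5 for K3-fibred threefolds.

Everything here is a real definition with its closure properties proved; no named facts. Not
here: the comparison maps with singular cohomology / sheaf cohomology, cup products, the Hodge
structure, the rank formula `h¹(j_*𝕍) = Σ R(p) + (2g − 2) rank 𝕍`.

## References

* [Deligne1970] P. Deligne, Équations différentielles à points singuliers réguliers, LNM 163, I.1.
* [HatcherAT2002] A. Hatcher, Algebraic Topology, §3.H (cohomology with local coefficients).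
* [DelAngelMullerStachVanStratenZuo2010] P. L. del Angel, S. Müller-Stach, D. van Straten, K. Zuo,
  Hodge classes associated to 1-parameter families of Calabi–Yau 3-folds, Acta Math. Vietnam. 35
  (2010), §0 and §4.
* [Zucker1979] S. Zucker, Hodge theory with degenerating coefficients, Ann. of Math. 109 (1979).
-/

noncomputable section

open CategoryTheory
open _root_.Topology _root_.Filter

universe u

namespace Literature.AlgebraicGeometry.Motives.LocalSystem

section Cocycles

variable {R : Type u} [Ring R] {S : Type u} [TopologicalSpace S] (V : LocalSystem R S)

/-- **Twisted `1`-cochains** of `𝕍` on the fundamental groupoid: a value `c(γ) ∈ 𝕍_t` for every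
homotopy class of paths `γ` from `s` to `t`. [folklore] -/
abbrev OneCochain : Type u :=
  ∀ (s t : S), Path.Homotopic.Quotient s t → V.fiber t

/-- **Twisted `1`-cocycles** (crossed homomorphisms on the fundamental groupoid):
`c(γ · δ) = δ_* c(γ) + c(δ)` for composable `γ : s ⇝ t`, `δ : t ⇝ w`. On loops at `s` these are
the crossed homomorphisms `π₁(S, s) → 𝕍_s` computing `H¹(π₁(S, s), 𝕍_s) = H¹(S; 𝕍)`.
[cite: HatcherAT2002, §3.H] -/
def oneCocycles : Submodule R V.OneCochain where
  carrier := {c | ∀ (s t w : S) (γ : Path.Homotopic.Quotient s t) (δ : Path.Homotopic.Quotient t w),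
    c s w (γ.trans δ) = V.transport δ (c s t γ) + c t w δ}
  zero_mem' := fun s t w γ δ => by simp
  add_mem' := fun {a b} ha hb s t w γ δ => by
    simp only [Pi.add_apply, map_add, ha s t w γ δ, hb s t w γ δ]
    abel
  smul_mem' := fun r a ha s t w γ δ => by
    simp only [Pi.smul_apply, map_smul, ha s t w γ δ, smul_add]

/-- The cocycle identity, unfolded. [cite: HatcherAT2002, §3.H] -/
theorem mem_oneCocycles_iff (c : V.OneCochain) :
    c ∈ V.oneCocycles ↔ ∀ (s t w : S) (γ : Path.Homotopic.Quotient s t)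
      (δ : Path.Homotopic.Quotient t w), c s w (γ.trans δ) = V.transport δ (c s t γ) + c t w δ :=
  Iff.rfl

/-- **The coboundary of a `0`-cochain** `v` (a not necessarily flat family `v(s) ∈ 𝕍_s`):
`(dv)(γ : s ⇝ t) = v(t) − γ_* v(s)`. [cite: HatcherAT2002, §3.H] -/
def oneCoboundary : (∀ s : S, V.fiber s) →ₗ[R] V.OneCochain where
  toFun v s t γ := v t - V.transport γ (v s)
  map_add' a b := by
    funext s t γ
    simp only [Pi.add_apply, map_add]
    abel
  map_smul' r a := by
    funext s t γ
    simp only [Pi.smul_apply, map_smul, RingHom.id_apply, smul_sub]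

/-- `oneCoboundary` unfolded. [folklore] -/
@[simp]
theorem oneCoboundary_apply (v : ∀ s : S, V.fiber s) (s t : S) (γ : Path.Homotopic.Quotient s t) :
    V.oneCoboundary v s t γ = v t - V.transport γ (v s) :=
  rfl

/-- Coboundaries are cocycles (`(γδ)_* = δ_* γ_*`). [cite: HatcherAT2002, §3.H] -/
theorem oneCoboundary_mem_oneCocycles (v : ∀ s : S, V.fiber s) :
    V.oneCoboundary v ∈ V.oneCocycles := by
  intro s t w γ δ
  simp only [oneCoboundary_apply, V.transport_trans, LinearMap.comp_apply, map_sub]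
  abel

/-- A flat family has zero coboundary: `dv = 0 ↔ v ∈ Γ(S, 𝕍)`. [cite: Deligne1970, I.1] -/
theorem oneCoboundary_eq_zero_iff (v : ∀ s : S, V.fiber s) :
    V.oneCoboundary v = 0 ↔ v ∈ V.flatSections := by
  simp only [mem_flatSections_iff, funext_iff, oneCoboundary_apply, Pi.zero_apply, sub_eq_zero]
  exact ⟨fun h s t γ => (h s t γ).symm, fun h s t γ => (h s t γ).symm⟩

/-- **The `1`-coboundaries `B¹ ⊆ Z¹`**, as a submodule of the cocycles. [cite: HatcherAT2002, §3.H] -/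
def oneCoboundaries : Submodule R V.oneCocycles :=
  (LinearMap.range V.oneCoboundary).comap V.oneCocycles.subtype

/-- Membership in `B¹`: being the coboundary of some `0`-cochain. [cite: HatcherAT2002, §3.H] -/
theorem mem_oneCoboundaries_iff (c : V.oneCocycles) :
    c ∈ V.oneCoboundaries ↔ ∃ v : ∀ s : S, V.fiber s, V.oneCoboundary v = c.1 := by
  simp [oneCoboundaries]

/-- **`H¹(S; 𝕍) := Z¹/B¹`**, the first cohomology of `S` with coefficients in the local system `𝕍`
(fundamental-groupoid model; `= H¹(π₁(S, s), 𝕍_s)` for `S` path connected). [cite: HatcherAT2002, §3.H] -/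
abbrev H1 : Type u :=
  V.oneCocycles ⧸ V.oneCoboundaries

/-- The class `[c] ∈ H¹(S; 𝕍)` of a cocycle. [cite: HatcherAT2002, §3.H] -/
abbrev H1.mk : V.oneCocycles →ₗ[R] V.H1 :=
  V.oneCoboundaries.mkQ

/-- Coboundaries have zero class. [cite: HatcherAT2002, §3.H] -/
theorem H1.mk_eq_zero_of_mem {c : V.oneCocycles} (hc : c ∈ V.oneCoboundaries) : H1.mk V c = 0 :=
  (Submodule.Quotient.mk_eq_zero _).2 hc

/-! ### Cocycles that are coboundaries over a subset -/

/-- **`c` is a coboundary over `W ⊆ S`**: for some family `v(s) ∈ 𝕍_s`, `s ∈ W`, one has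
`c(γ) = v(t) − γ_* v(s)` for every homotopy class `γ` of paths INSIDE `W` from `s` to `t` (viewed in
`S`); i.e. the extension `0 → 𝕍 → 𝕍̂ → R_S → 0` classified by `c` splits over `W`.
[cite: DelAngelMullerStachVanStratenZuo2010, §4] -/
def IsCoboundaryOn (c : V.OneCochain) (W : Set S) : Prop :=
  ∃ v : ∀ s : W, V.fiber s.1, ∀ (s t : W) (γ : Path.Homotopic.Quotient s t),
    c s.1 t.1 (γ.map ⟨Subtype.val, continuous_subtype_val⟩) =
      v t - V.transport (γ.map ⟨Subtype.val, continuous_subtype_val⟩) (v s)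

variable {V}

/-- A coboundary over `W` is a coboundary over every smaller `W'`. [folklore] -/
theorem IsCoboundaryOn.mono {c : V.OneCochain} {W W' : Set S} (h : V.IsCoboundaryOn c W)
    (hW : W' ⊆ W) : V.IsCoboundaryOn c W' := by
  obtain ⟨v, hv⟩ := h
  refine ⟨fun s => v ⟨s.1, hW s.2⟩, fun s t γ => ?_⟩
  have key := hv ⟨s.1, hW s.2⟩ ⟨t.1, hW t.2⟩ (γ.map ⟨Set.inclusion hW, continuous_inclusion hW⟩)
  rw [← Path.Homotopic.Quotient.map_comp] at key
  exact key

/-- Sums of coboundaries over `W` are coboundaries over `W`. [folklore] -/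
theorem IsCoboundaryOn.add {c c' : V.OneCochain} {W : Set S} (h : V.IsCoboundaryOn c W)
    (h' : V.IsCoboundaryOn c' W) : V.IsCoboundaryOn (c + c') W := by
  obtain ⟨v, hv⟩ := h
  obtain ⟨v', hv'⟩ := h'
  refine ⟨v + v', fun s t γ => ?_⟩
  simp only [Pi.add_apply, hv s t γ, hv' s t γ, map_add]
  abel

/-- Scalar multiples of coboundaries over `W` are coboundaries over `W`. [folklore] -/
theorem IsCoboundaryOn.smul {c : V.OneCochain} {W : Set S} (h : V.IsCoboundaryOn c W) (r : R) :
    V.IsCoboundaryOn (r • c) W := by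
  obtain ⟨v, hv⟩ := h
  refine ⟨r • v, fun s t γ => ?_⟩
  simp only [Pi.smul_apply, hv s t γ, map_smul, smul_sub]

variable (V)

/-- The zero cochain is a coboundary over every `W`. [folklore] -/
theorem isCoboundaryOn_zero (W : Set S) : V.IsCoboundaryOn 0 W :=
  ⟨0, fun s t γ => by simp⟩

/-- A (global) coboundary is a coboundary over every `W` (restrict the `0`-cochain). [folklore] -/
theorem isCoboundaryOn_oneCoboundary (v : ∀ s : S, V.fiber s) (W : Set S) :
    V.IsCoboundaryOn (V.oneCoboundary v) W :=
  ⟨fun s => v s.1, fun _ _ _ => rfl⟩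

end Cocycles

/-! ### Parabolic cocycles and `H¹(T, j_*𝕍)` for a local system on a subspace `U ⊆ T` -/

section Parabolic

variable {R : Type u} [Ring R] {T : Type u} [TopologicalSpace T] {U : Set T} (V : LocalSystem R U)

/-- **`c` is parabolic at `b ∈ T`** (for `𝕍` on the subspace `j : U ↪ T`): over `N ∩ U` for some
neighbourhood `N` of `b` in `T`, `c` is a coboundary — the extension classified by `c` "splits
locally near" `b`; for `b` a puncture of a curve this is the vanishing of `[c]` in
`(R¹j_*𝕍)_b = H¹(Δ_b^*, 𝕍) = 𝕍/(γ_b − 1)𝕍`. [cite: DelAngelMullerStachVanStratenZuo2010, §4] -/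
def IsParabolicAt (c : V.OneCochain) (b : T) : Prop :=
  ∃ N ∈ 𝓝 b, V.IsCoboundaryOn c {s : U | s.1 ∈ N}

variable {V} in
/-- Parabolicity at `b` is stable under sums (intersect the neighbourhoods). [folklore] -/
theorem IsParabolicAt.add {c c' : V.OneCochain} {b : T} (h : V.IsParabolicAt c b)
    (h' : V.IsParabolicAt c' b) : V.IsParabolicAt (c + c') b := by
  obtain ⟨N, hN, hc⟩ := h
  obtain ⟨N', hN', hc'⟩ := h'
  exact ⟨N ∩ N', inter_mem hN hN',
    (hc.mono fun s hs => hs.1).add (hc'.mono fun s hs => hs.2)⟩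

/-- **The parabolic cocycles**: cocycles of `𝕍` on `U` that are coboundaries near every point of
`T` ("extensions which split locally near each point `p ∈ D`"; at points of `U` the condition is
automatic when `U` is locally simply connected). [cite: DelAngelMullerStachVanStratenZuo2010, §4] -/
def parabolicCocycles : Submodule R V.oneCocycles where
  carrier := {c | ∀ b : T, V.IsParabolicAt c.1 b}
  zero_mem' := fun b => ⟨Set.univ, univ_mem, V.isCoboundaryOn_zero _⟩
  add_mem' := fun ha hb b => (ha b).add (hb b)
  smul_mem' := fun r c hc b => by
    obtain ⟨N, hN, h⟩ := hc b
    exact ⟨N, hN, h.smul r⟩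

/-- Membership in the parabolic cocycles, unfolded. [cite: DelAngelMullerStachVanStratenZuo2010, §4] -/
theorem mem_parabolicCocycles_iff (c : V.oneCocycles) :
    c ∈ V.parabolicCocycles ↔ ∀ b : T, V.IsParabolicAt c.1 b :=
  Iff.rfl

/-- Coboundaries are parabolic. [cite: DelAngelMullerStachVanStratenZuo2010, §4] -/
theorem oneCoboundaries_le_parabolicCocycles : V.oneCoboundaries ≤ V.parabolicCocycles := by
  intro c hc b
  obtain ⟨v, hv⟩ := (V.mem_oneCoboundaries_iff c).1 hc
  exact ⟨Set.univ, univ_mem, hv ▸ V.isCoboundaryOn_oneCoboundary v _⟩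

/-- **The parabolic cohomology `H¹(T, j_*𝕍) ⊆ H¹(U; 𝕍)`**: the classes of parabolic cocycles
("The parabolic subspace `H¹(S̄, j_*𝕍) ⊂ H¹(S, 𝕍)` consists precisely of those extensions which
split locally near each point `p ∈ D`"); Zucker's intersection/`L²` cohomology group for `T` a
compact curve and `U` the complement of finitely many points.
[cite: DelAngelMullerStachVanStratenZuo2010, §0 and §4] [cite: Zucker1979, Introduction] -/
def parabolicH1 : Submodule R V.H1 :=
  V.parabolicCocycles.map (H1.mk V)

/-- A class is parabolic iff it is represented by a parabolic cocycle (all representatives then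
are, coboundaries being parabolic). [cite: DelAngelMullerStachVanStratenZuo2010, §4] -/
theorem mk_mem_parabolicH1_iff (c : V.oneCocycles) :
    H1.mk V c ∈ V.parabolicH1 ↔ c ∈ V.parabolicCocycles := by
  constructor
  · rintro ⟨c', hc', h⟩
    have hdiff : c - c' ∈ V.oneCoboundaries := by
      rw [← Submodule.Quotient.eq]
      exact h.symm
    have := add_mem (V.oneCoboundaries_le_parabolicCocycles hdiff) hc'
    simpa using this
  · exact fun hc => ⟨c, hc, rfl⟩

end Parabolic

end Literature.AlgebraicGeometry.Motives.LocalSystem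

end
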